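import Literature.MathematicalPhysics.QuantumFieldTheory.Balaban1983to89.B9CoReadingCoordsS
import Literature.MathematicalPhysics.QuantumFieldTheory.Balaban1983to89.B9Eq352GradLetters

/-!
# `Balaban1983to89.Node00.OpsYRead342` — THE SAME-CONFIGURATION (3.42) DICTIONARY OF NODE 00's READING: the four sup entries of
# `Node00.kernelFamilyS i B cfg O par` at `V := cfg U₁` (def-Y's `η^{(2,1,1,0)}`-weighted sups over the unit ball of `𝔸` of block sups of
# `‖(O(V)(f ⊗ E))(z)‖`, `‖(∇_{V,μ}O(V)(f ⊗ E))(z)‖`, `‖(O(V)∇*_{V,μ}(f ⊗ E))(z)‖`, `‖(Δ_V O(V)(f ⊗ E))(z)‖`) ⟷ r06's BLOCK MAJORANTS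
# (`B6RandomWalk.HasMajorant`, [4] (2.51)) of the `b`-CONJUGATED LETTERS (`B9Eq352DivFormLetters.conj b`) `η²O(V)`, `(η⁻¹∇_{V,μ})∘(η²O(V))`,
# `(η²O(V))∘(−η⁻¹∇*_{V,μ})`, `(η⁻²Δ_V)∘(η²O(V))` on real coordinates `SiteY i × ι → ℝ` — BOTH WAYS, generic over the index `i`, the backgrounds
# record `B`, `cfg`, the letter `O`, `par`, `U₁`, a real basis `b` of `𝔸` with a coordinate bound `M₂`, and a section `ιB` of the carrier map `β`.

WHY THIS FILE (def-Y g13; the OpsY-instance owner's side of n06-c's residual (i) «prove `Read342Y` ∕ `Write342Y` for `K := kernelFamilyS …`»,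
fleet bus l.22921).  dag-n06-c's frame `B9SectBGpStepAtLettersV2.GpFrame₂` (p495320; stated over r06's LETTERS `B9Eq352DivFormLetters.conj` ∕
`B9Eq352GradLetters.diffLetter`) asks, in its fields `read342` ∕ `write342`, that the (3.42) block `EBlock K B₀ δ U`
of the propagator family BE (both ways, «of course with different constants») a family of block majorants `c·B₀·ℓ(a)^{(2,1,1,0)}·e^{−δd(a,a′)}` of the
conjugated letters `Gop U = conj b (η²G′(U))`, `conj b (∇-letter_k) * Gop U`, `Gop U * conj b (∇-letter_k)`, `Lap U * Gop U`.  At NODE 00 the family IS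
NODE 00's own `kernelFamilyS` (n06-c's `gpFrame₂Coded`, via `pullK`), whose entries are literally sups of the four operator norms above; this file proves the
part of that dictionary which holds AT ONE AND THE SAME CONFIGURATION and for the ORIENTATIONS the entries of the reading carry (`∇_μ∘O` = forward
letter on the LEFT, `O∘∇*_μ` = backward letter on the RIGHT):
* §1 bookkeeping: block sups dominate pointwise norms (`norm_le_supBlkS`, `norm_le_supBlkS'`); the ball sup dominates its members once a uniform bound is
  known (`le_iSup_ball`); the basis decomposition `f ⊗ E = Σ_j (repr_j E)·(f ⊗ b_j)` (`liftY_eq_sum_repr`) and the resulting UNIFORM bound of an ℝ-linear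
  image over the ball (`norm_apply_liftY_le_of_repr`); carrier-level bookkeeping `ℓ(c) ∕ d(c,c′)` depend on `β c` only (`geo9K_len_congr`, `geo9K_dist_congr`).
* §2 the three LETTER COMPOSITES unfolded at def-Y's operators: `(η⁻¹∇_μ-letter) * G = η·∇_{V,μ}∘O(V)`, `G * (−η⁻¹∇*_μ-letter) = −η·O(V)∘∇*_{V,μ}`,
  `L * G = Δ_V∘O(V)` for ANY ℝ-linear `G`, `L` with `G Λ = η²·O(V)Λ`, `L Λ = η⁻²·Δ_V Λ` (hypothesis style; in §4–§5 the scale `η` and the connection `Uc`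
  of the derivative letters are free letters tied by `η = etaS i`, `Uc = UboxY i (cfg U₁)`, so n06-c's spellings `GopC ∕ LapC ∕ coordC` (`B9SectBGpLettersY`,
  `(kGeo i).eta`, `lapSL`, `coordC` at a `G`-valued base) are served after `B9Ineq349SiteFromBlocks.etaS_eq_abs_cf_inv` at the members of record).
* §3 ★ READ, generic core: an ℝ-linear, ℂ-homogeneous `T` on `SiteY i → 𝔸` whose values on `f ⊗ E`, `‖E‖ ≤ 1`, `supp f ⊂ Δ(β y′)` are bounded on the block
  of `y` by `W(y,y′)·|f|` has `conj b T` majorised by `M₂·(Σ_j‖b_j‖)·W` w.r.t. the block map `(z, j) ↦ ιB(Δ(z))` (`hasMajorant_conj_of_ball_bound`) — the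
  (2.51) reading of [4] p.232 («|(Tλ)(x)| ≤ K(y,y′)|λ|») for 𝔸-valued operators through coordinates.
* §4 ★★ READ at def-Y's entries: `EBlock (kernelFamilyS i B cfg O par) B₀ δ U₁` ⇒ the pointwise entry bounds at every `E` of the ball
  (`sq_eta_mul_norm_le_of_eBlock`, `eta_mul_norm_cdS_le_of_eBlock`, `eta_mul_norm_cdsS_le_of_eBlock`, `norm_lapS_le_of_eBlock`) ⇒ the four block majorants
  with constant `M₂·(Σ_j‖b_j‖)·B₀` and the SAME rate `δ` (`hasMajorant_conj_G_of_eBlock`, `hasMajorant_gradF_mul_G_of_eBlock` (k = inl μ, left),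
  `hasMajorant_G_mul_gradB_of_eBlock` (k = inr μ, right), `hasMajorant_lap_mul_G_of_eBlock`).
* §5 ★★ WRITE at the same configuration: the four majorant families with constant `B` and rate `δ` ⇒ `EBlock (kernelFamilyS i B cfg O par) (M₂·(Σ_j‖b_j‖)·B) δ U₁`
  (`norm_apply_liftY_le_of_hasMajorant`, `eBlock_kernelFamilyS_of_hasMajorant`).
LOCATED OBSERVATION (L-READ342-δ, reported on the fleet bus l.23102, for the frame owner dag-n06-c; the page owner lit-balaban-r06 AGREED AS TO PRINT,
QUOTATION CHECK #9, bus l.23373: (3.42) p.397 has exactly four entries, «∇_U» on the LEFT of «G′(U)» and «∇*_U» on the RIGHT only): the two REMAINING orientation combos of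
`read342` (`conj b (−η⁻¹∇*_μ-letter) * Gop` and `Gop * conj b (η⁻¹∇_μ-letter)`) are NOT entries of (3.42); at NODE 00's letters they follow from the
entries only after a shift by one bond (`∇*_μ = −R(U⁻¹)τ_{−μ}∇_μ`), which moves the evaluation ∕ support block to a NEIGHBOUR block and costs a factor
`L·e^{δ·d₀}` (`d₀` = the diameter of the one-bond block stencil) — not uniform in `δ`, whereas the field quantifies `∀ δ > 0` with a `δ`-free `cR`; the
frame consumes `read342` only through `read342_le` at rates `≤ δcap`, so the repair is a cap `δ ≤ δcap` in the field (or in `Read342Y`).  Those two combos and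
the `U ↦ U′U` conversion of `write342` (class (3.37), block spill) are NOT in this file.
v1.1 (def-Y g14, 2026-08-27; DOCSTRINGS ONLY, code tokens byte-identical to v1 p570392): r06 QUOTATION CHECK #9 (bus l.23373) — (a) (3.23) displays on
p.394 (not p.395); (b) the frame `GpFrame₂` and its fields `read342` ∕ `write342` are dag-n06-c's (`B9SectBGpStepAtLettersV2`, p495320), r06's are the letters
this file opens (`B9Eq352DivFormLetters`, `B9Eq352GradLetters`); plus r06's print word on L-READ342-δ recorded above; (c) ref-E g12
DISCHARGE READ-8 of p570392 (bus l.23427, GAP-STATED(`hι`)): the CORNER-FREE restriction now named in HONEST SCOPE.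
HONEST SCOPE.  Finite-dimensional linear algebra and sup bookkeeping over def-Y's definitions `kernelFamilyS ∕ eLatS ∕ supBlkS ∕ cdS ∕ cdsS ∕ lapS ∕ liftY`
and r06's `conj ∕ coordEquiv ∕ gradLetterF ∕ gradLetterB ∕ diffLetter ∕ HasMajorant ∕ EBlock`; every bound is an identity-level consequence of the cited
shapes ([4] (2.51) p.232 «|(Tλ)(x)| ≤ K(y,y′)|λ|, x ∈ B^j(y), supp λ ⊂ B^{j′}(y′)»; [B9] (3.42) p.397).  CORNER-FREE MEMBERS ONLY (ref-E READ-8):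
all six dictionary theorems (§3 `hasMajorant_conj_of_ball_bound`, the four §4 READ majorants, §5 `eBlock_kernelFamilyS_of_hasMajorant`) carry a SECTION
`ιB : BlkY i → IBondY i` of the carrier-block map, `hι : ∀ s, β i.hN i.D i.hk (ιB s) = s`; such a section exists iff `β` is onto `𝔅` iff the member has NO
INNER CORNER (`B9BetaRangeKLevelV1.surjective_beta_iff` ∕ `not_surjective_beta_of_corner`; [4] (2.3) p.224, (2.45) p.231) — at a member with an inner-corner
block no `ιB` exists, the six theorems are then hypotheses nobody can supply, and the (2.51)⇄(3.42) transfer must be RE-STATED on `range β` (block maps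
into `Set.range β`, majorants indexed there); that restatement is NOT in this file.  Nothing of [B9] Thm 3.1 or of [4] Prop. 2.2 is
asserted; no constant of print is computed; COUNT-NEUTRAL; N06 NOT discharged; one finite 𝕋⁴ programme at fixed ε — nothing continuum, nothing about the
mass gap.  Cell `pub-ymgap` (HUMAN RULING D-0062), Track A node N06 [B9], seat `pub-ymgap-node00-def-Y` (g13), 2026-08-27.
-/

namespace Literature.MathematicalPhysics.QuantumFieldTheory.Balaban1983to89.Node00.OpsYRead342

open B6Geom246MultiLevelBox (bset blkOf)
open B6Geom246MultiLevelTorus (geomT)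
open B6Ineq2142KLevelV1 (β lvl beta_level)
open B6KLevelCensusIndexV1 (KIdx kGeo)
open B6Prop22KLevelCensusEta (epow)
open B6RandomWalk (HasMajorant BlockSupp hasMajorant_mono)
open B9Thm34Ext (toB6)
open B9FromB6 (EBlock)
open B9GeoNormsKLevelV1 (geo9K geo9K_supNorm_nonneg geo9K_len_kGeo)
open B9Eq39Adjoint (covD covDstar covD_smul covDstar_smul)
open B9Eq352DivFormLetters (coordEquiv conj conj_apply coordEquiv_apply coordEquiv_symm_apply gradLetterF gradLetterB
  gradLetterF_apply gradLetterB_apply)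
open B9Eq352GradLetters (diffLetter diffLetter_inl diffLetter_inr)
open B9Ineq347AllEntries (pref4_nonneg)
open B9Ineq349SiteComposite (cdSL cdsSL cdSL_apply cdsSL_apply supBlkS_le supBlkS'_le etaS_pos norm_le_norm_mul_of_ball)
open B9CoReadingCoords (norm_le_basisBound_mul)
open B9Thm39ReadingCoords (basisBound39)
open B9CoReadingCoordsS (lapSₗ lapSₗ_apply)

variable {d ℓ : ℕ} {hd : 1 ≤ d + 1} {hL : Odd (ℓ + 1) ∧ 1 < ℓ + 1} {b₀ b₁ : ℝ}
variable {𝔸 : Type} [NormedRing 𝔸] [NormedAlgebra ℂ 𝔸] [CompleteSpace 𝔸]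
variable {ι : Type} [Fintype ι]
variable (i : KIdx d ℓ hd hL b₀ b₁) (b : Module.Basis ι ℝ 𝔸)

/-! ## §1 Bookkeeping: block sups, the ball sup, the basis decomposition, carrier-level lengths and distances -/

section Bookkeeping

omit [NormedAlgebra ℂ 𝔸] [CompleteSpace 𝔸] [Fintype ι] in
/-- a block sup dominates the norm at every site of the block («x ∈ Δ(y)»). [cite: Balaban1985BackgroundPropagators, (3.42) p.397, bookkeeping] -/
theorem norm_le_supBlkS (s : BlkY i) (Ψ : SiteY i → 𝔸) {z : SiteY i} (hz : blkOf i.D.toDomains z = s) : ‖Ψ z‖ ≤ supBlkS i s Ψ := by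
  classical
  have h : (if blkOf i.D.toDomains z = s then ‖Ψ z‖ else 0) ≤ supBlkS i s Ψ :=
    le_ciSup (f := fun w : SiteY i => if blkOf i.D.toDomains w = s then ‖Ψ w‖ else 0) (Set.finite_range _).bddAbove z
  rwa [if_pos hz] at h

omit [NormedAlgebra ℂ 𝔸] [CompleteSpace 𝔸] [Fintype ι] in
/-- a directional block sup dominates the norm at every site of the block and every direction. [cite: Balaban1985BackgroundPropagators, (3.42) p.397, bookkeeping] -/
theorem norm_le_supBlkS' (s : BlkY i) (Ψ : Fin (d + 1) → SiteY i → 𝔸) {z : SiteY i} (μ : Fin (d + 1)) (hz : blkOf i.D.toDomains z = s) :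
    ‖Ψ μ z‖ ≤ supBlkS' i s Ψ := by
  classical
  have h : (if blkOf i.D.toDomains ((z, μ) : SiteY i × Fin (d + 1)).1 = s then ‖Ψ ((z, μ) : SiteY i × Fin (d + 1)).2 ((z, μ) : SiteY i × Fin (d + 1)).1‖ else 0)
      ≤ supBlkS' i s Ψ :=
    le_ciSup (f := fun p : SiteY i × Fin (d + 1) => if blkOf i.D.toDomains p.1 = s then ‖Ψ p.2 p.1‖ else 0) (Set.finite_range _).bddAbove (z, μ)
  rwa [if_pos hz] at h

omit [Fintype ι] in
/-- the sup over the unit ball dominates each member, once a uniform bound is known («|λ|»-normalisation of the 𝔸-amplitude).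
[cite: Balaban1985BackgroundPropagators, (3.42) p.397, bookkeeping] -/
private theorem le_iSup_ball {F : BallY 𝔸 → ℝ} {C : ℝ} (hC : ∀ E, F E ≤ C) (E : BallY 𝔸) : F E ≤ ⨆ E', F E' :=
  le_ciSup ⟨C, by rintro _ ⟨E', rfl⟩; exact hC E'⟩ E

omit [CompleteSpace 𝔸] in
/-- the basis decomposition of the amplitude: `f ⊗ E = Σ_j (repr_j E)·(f ⊗ b_j)`. [cite: Balaban1985BackgroundPropagators, (3.39) p.397, bookkeeping] -/
theorem liftY_eq_sum_repr {X : Type} (f : X → ℝ) (E : 𝔸) : liftY (X := X) f E = ∑ j, (b.repr E j) • liftY f (b j) := by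
  funext w
  rw [Finset.sum_apply, liftY_apply]
  conv_lhs => rw [← b.sum_repr E]
  rw [Finset.smul_sum]
  refine Finset.sum_congr rfl fun j _ => ?_
  rw [Pi.smul_apply, liftY_apply, smul_comm]

omit [CompleteSpace 𝔸] in
/-- the amplitude scales: `f ⊗ (cE) = c·(f ⊗ E)`. [cite: Balaban1985BackgroundPropagators, (3.39) p.397, bookkeeping] -/
theorem liftY_smul_right {X : Type} (f : X → ℝ) (c : ℂ) (E : 𝔸) : liftY (X := X) f (c • E) = c • liftY f E := by
  funext w; rw [liftY_apply, Pi.smul_apply, liftY_apply, smul_comm]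

omit [CompleteSpace 𝔸] in
/-- ★ a UNIFORM bound over the unit ball of an ℝ-linear image of the amplitudes `f ⊗ E`, from a coordinate bound `|repr_j v| ≤ M₂‖v‖`:
`‖(T(f ⊗ E))(z)‖ ≤ M₂·Σ_j Σ_w ‖(T(f ⊗ b_j))(w)‖`. [cite: Balaban1985BackgroundPropagators, (3.42) p.397 (sup over |λ| ≤ 1), bookkeeping] -/
theorem norm_apply_liftY_le_of_repr (T : Module.End ℝ (SiteY i → 𝔸)) {M₂ : ℝ} (hM₂ : 0 ≤ M₂)
    (hrepr : ∀ (v : 𝔸) (j : ι), |b.repr v j| ≤ M₂ * ‖v‖) (f : SiteY i → ℝ) {E : 𝔸} (hE : ‖E‖ ≤ 1) (z : SiteY i) :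
    ‖T (liftY f E) z‖ ≤ M₂ * ∑ j, ∑ w, ‖T (liftY f (b j)) w‖ := by
  rw [liftY_eq_sum_repr b f E, map_sum, Finset.sum_apply, Finset.mul_sum]
  refine (norm_sum_le _ _).trans (Finset.sum_le_sum fun j _ => ?_)
  rw [map_smul, Pi.smul_apply, norm_smul, Real.norm_eq_abs]
  calc |b.repr E j| * ‖T (liftY f (b j)) z‖ ≤ M₂ * ‖T (liftY f (b j)) z‖ :=
        mul_le_mul_of_nonneg_right ((hrepr E j).trans (mul_le_of_le_one_right hM₂ hE)) (norm_nonneg _)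
    _ ≤ M₂ * ∑ w, ‖T (liftY f (b j)) w‖ :=
        mul_le_mul_of_nonneg_left (Finset.single_le_sum (f := fun w => ‖T (liftY f (b j)) w‖) (fun _ _ => norm_nonneg _) (Finset.mem_univ z)) hM₂

omit [Fintype ι] in
/-- the (2.67)∕(3.42) length `ℓ(c) = L^{j}|c_f|⁻¹` of a carrier index depends on its carrier block only. [cite: Balaban1985BackgroundPropagators, (3.41) p.397, bookkeeping] -/
theorem geo9K_len_congr {c c' : IBondY i} (h : β i.hN i.D i.hk c = β i.hN i.D i.hk c') : (geo9K i).len c = (geo9K i).len c' := by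
  have hk1 : 1 ≤ i.k := le_trans (by norm_num) i.hk2
  rw [geo9K_len_kGeo, geo9K_len_kGeo, B6KLevelCensusIndexV1.len_eq, B6KLevelCensusIndexV1.len_eq, ← beta_level i.hN i.D i.hk hk1 c, ← beta_level i.hN i.D i.hk hk1 c', h]

omit [Fintype ι] in
/-- the (2.46) distance of carrier indices depends on their carrier blocks only. [cite: Balaban1984PropagatorsII, (2.46) p.231, bookkeeping] -/
theorem geo9K_dist_congr {a a' c c' : IBondY i} (ha : β i.hN i.D i.hk a = β i.hN i.D i.hk a') (hc : β i.hN i.D i.hk c = β i.hN i.D i.hk c') :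
    (geo9K i).dist a c = (geo9K i).dist a' c' := by
  show (geomT i.D).dist (β i.hN i.D i.hk a) (β i.hN i.D i.hk c) = (geomT i.D).dist (β i.hN i.D i.hk a') (β i.hN i.D i.hk c')
  rw [ha, hc]

omit [Fintype ι] in
/-- `0 ≤ ℓ(c)` (`B9GeoLemma21KLevelV1.geo9K_len_pos`, weak form). [cite: Balaban1985BackgroundPropagators, (3.41) p.397, bookkeeping] -/
private theorem geo9K_len_nonneg (c : IBondY i) : 0 ≤ (geo9K i).len c := (B6KLevelCensusIndexV1.len_pos i c).le

omit [Fintype ι] in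
/-- `|f| ≥ |f(w)|` for the sup norm of a site localisation. [cite: Balaban1985BackgroundPropagators, (3.42) p.397 («|λ|»), bookkeeping] -/
theorem abs_le_supNorm_inl (f : SiteY i → ℝ) (w : SiteY i) : |f w| ≤ (geo9K i).supNorm (Sum.inl f) :=
  le_ciSup (f := fun x => |f x|) (Set.finite_range _).bddAbove w

end Bookkeeping

/-! ## §2 The letter composites unfolded at def-Y's operators -/

section Letters

variable (O : SiteOpY 𝔸 i) (V : CfgY 𝔸 i)

omit [Fintype ι] in
/-- `(η⁻¹∇_μ-letter) * G = η·∇_{V,μ}∘O(V)` for `G = η²O(V)`: the second (3.42) member's operator. [cite: Balaban1985BackgroundPropagators, (3.42) p.397 («∇_U G′(U)»), (3.3) p.390] -/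
theorem gradF_mul_apply (G : Module.End ℝ (SiteY i → 𝔸)) (hG : ∀ Λ, G Λ = (etaS i ^ 2) • O V Λ) (μ : Fin (d + 1)) (Λ : SiteY i → 𝔸) (w : SiteY i) :
    (gradLetterF (shiftY i) (UboxY i V) ((((etaS i : ℝ) : ℂ))⁻¹) μ * G) Λ w = ((etaS i : ℝ) : ℂ) • cdS i V μ (O V Λ) w := by
  have hη : ((etaS i : ℝ) : ℂ) ≠ 0 := by exact_mod_cast (etaS_pos i).ne'
  rw [Module.End.mul_apply, gradLetterF_apply, hG, ← Complex.coe_smul, covD_smul, smul_smul]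
  show ((((etaS i : ℝ) : ℂ))⁻¹ * (((etaS i ^ 2 : ℝ)) : ℂ)) • cdS i V μ (O V Λ) w = _
  congr 1
  push_cast
  rw [pow_two, inv_mul_cancel_left₀ hη]

omit [Fintype ι] in
/-- `G * (−η⁻¹∇*_μ-letter) = −η·O(V)∘∇*_{V,μ}` for `G = η²O(V)`: the third (3.42) member's operator (up to sign). [cite: Balaban1985BackgroundPropagators, (3.42) p.397 («G′(U)∇*_U»), (3.8) p.392] -/
theorem mul_neg_gradB_apply (G : Module.End ℝ (SiteY i → 𝔸)) (hG : ∀ Λ, G Λ = (etaS i ^ 2) • O V Λ) (μ : Fin (d + 1)) (Λ : SiteY i → 𝔸) (w : SiteY i) :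
    (G * -gradLetterB (shiftY i) (UboxY i V) ((((etaS i : ℝ) : ℂ))⁻¹) μ) Λ w = -(((etaS i : ℝ) : ℂ) • O V (cdsS i V μ Λ) w) := by
  have hη : ((etaS i : ℝ) : ℂ) ≠ 0 := by exact_mod_cast (etaS_pos i).ne'
  have hB : gradLetterB (shiftY i) (UboxY i V) ((((etaS i : ℝ) : ℂ))⁻¹) μ Λ = ((((etaS i : ℝ) : ℂ))⁻¹) • cdsS i V μ Λ := by
    funext x; rw [gradLetterB_apply, Pi.smul_apply]; rfl
  rw [Module.End.mul_apply, LinearMap.neg_apply, hG, hB, map_neg, map_smul, smul_neg, Pi.neg_apply, ← Complex.coe_smul, smul_smul,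
    Pi.smul_apply]
  congr 2
  push_cast
  rw [pow_two, mul_inv_cancel_right₀ hη]

omit [Fintype ι] in
/-- `L * G = Δ_V∘O(V)` for `G = η²O(V)`, `L = η⁻²Δ_V`: the fourth (3.42) member's operator. [cite: Balaban1985BackgroundPropagators, (3.42) p.397 («Δ_U G′(U)»), (3.23) p.394] -/
theorem lap_mul_apply (G L : Module.End ℝ (SiteY i → 𝔸)) (hG : ∀ Λ, G Λ = (etaS i ^ 2) • O V Λ) (hL : ∀ Λ, L Λ = (etaS i ^ 2)⁻¹ • lapS i V Λ)
    (Λ : SiteY i → 𝔸) (w : SiteY i) : (L * G) Λ w = lapS i V (O V Λ) w := by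
  have hη2 : (etaS i ^ 2 : ℝ) ≠ 0 := pow_ne_zero 2 (etaS_pos i).ne'
  rw [Module.End.mul_apply, hL, hG, ← lapSₗ_apply, map_smul, inv_smul_smul₀ hη2, lapSₗ_apply]

end Letters

/-! ## §3 READ, generic core: a ball bound of an ℝ-linear ℂ-homogeneous `T` gives a block majorant of `conj b T` ([4] (2.51) through coordinates) -/

section ReadCore

variable [Fintype (geo9K i).Site] {Rr : ℝ} {Hp : Prop}

omit [CompleteSpace 𝔸] in
/-- ★ **THE (2.51) READING THROUGH COORDINATES**: if `‖(T(f ⊗ E))(z)‖ ≤ W(y,y′)·|f|` for `‖E‖ ≤ 1`, `supp f ⊂ Δ(βy′)`, `z ∈ Δ(βy)`, then `conj b T` has the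
block majorant `M₂·(Σ_j‖b_j‖)·W` w.r.t. `(z, j) ↦ ιB(Δ(z))` (`ιB` a section of `β`). [cite: Balaban1984PropagatorsII, (2.51) p.232 («|(Tλ)(x)| ≤ K(y,y′)|λ|»); Balaban1985BackgroundPropagators, (3.42) p.397] -/
theorem hasMajorant_conj_of_ball_bound (T : Module.End ℝ (SiteY i → 𝔸)) (hT : ∀ (c : ℂ) (Λ : SiteY i → 𝔸), T (c • Λ) = c • T Λ)
    (ιB : BlkY i → IBondY i) (hι : ∀ s, β i.hN i.D i.hk (ιB s) = s)
    {M₂ : ℝ} (hM₂ : 0 ≤ M₂) (hrepr : ∀ (v : 𝔸) (j : ι), |b.repr v j| ≤ M₂ * ‖v‖)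
    (W : IBondY i → IBondY i → ℝ) (hW : ∀ a a', 0 ≤ W a a')
    (hTW : ∀ (f : SiteY i → ℝ) (y y' : IBondY i), (geo9K i).suppIn (Sum.inl f) y' → ∀ E : 𝔸, ‖E‖ ≤ 1 →
      ∀ z : SiteY i, blkOf i.D.toDomains z = β i.hN i.D i.hk y → ‖T (liftY f E) z‖ ≤ W y y' * (geo9K i).supNorm (Sum.inl f)) :
    HasMajorant (g := toB6 (geo9K i) Rr Hp) (fun p : SiteY i × ι => ιB (blkOf i.D.toDomains p.1)) (conj b T)
      (fun a a' => M₂ * (∑ j, ‖b j‖) * W a a') := by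
  intro y' μv Bμ hμ p
  have hsupp : ∀ j : ι, (geo9K i).suppIn (Sum.inl (fun w : SiteY i => μv (w, j))) y' := by
    intro j w hw
    have h1 : ιB (blkOf i.D.toDomains w) = y' := by
      by_contra hne
      exact hw (hμ.off (w, j) hne)
    have h2 := congrArg (β i.hN i.D i.hk) h1
    rw [hι] at h2
    exact h2
  have hsupN : ∀ j : ι, (geo9K i).supNorm (Sum.inl (fun w : SiteY i => μv (w, j))) ≤ Bμ := by
    intro j
    refine Real.iSup_le (fun w => ?_) hμ.nonneg
    by_cases hw : ιB (blkOf i.D.toDomains w) = y'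
    · exact hμ.bound (w, j) hw
    · show |μv (w, j)| ≤ Bμ
      rw [hμ.off (w, j) hw, abs_zero]; exact hμ.nonneg
  have hΛ : (coordEquiv b).symm μv = ∑ j, liftY (fun w : SiteY i => μv (w, j)) (b j) := by
    funext w
    rw [coordEquiv_symm_apply, Finset.sum_apply]
    refine Finset.sum_congr rfl fun j _ => ?_
    rw [liftY_apply, Complex.coe_smul]
  have hpiece : ∀ j : ι, ‖T (liftY (fun w : SiteY i => μv (w, j)) (b j)) p.1‖ ≤ ‖b j‖ * (W (ιB (blkOf i.D.toDomains p.1)) y' * Bμ) := by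
    intro j
    refine norm_le_norm_mul_of_ball (fun E : 𝔸 => T (liftY (fun w : SiteY i => μv (w, j)) E) p.1) ?_ ?_ (b j)
    · intro c F
      show T (liftY (fun w : SiteY i => μv (w, j)) (c • F)) p.1 = c • T (liftY (fun w : SiteY i => μv (w, j)) F) p.1
      rw [liftY_smul_right, hT, Pi.smul_apply]
    · intro F hF
      have hz : blkOf i.D.toDomains p.1 = β i.hN i.D i.hk (ιB (blkOf i.D.toDomains p.1)) := (hι _).symm
      exact (hTW _ _ y' (hsupp j) F hF p.1 hz).trans (mul_le_mul_of_nonneg_left (hsupN j) (hW _ _))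
  rw [conj_apply, hΛ, map_sum, Finset.sum_apply]
  calc |b.repr (∑ j, T (liftY (fun w : SiteY i => μv (w, j)) (b j)) p.1) p.2|
      ≤ M₂ * ‖∑ j, T (liftY (fun w : SiteY i => μv (w, j)) (b j)) p.1‖ := hrepr _ _
    _ ≤ M₂ * ∑ j, ‖b j‖ * (W (ιB (blkOf i.D.toDomains p.1)) y' * Bμ) :=
        mul_le_mul_of_nonneg_left ((norm_sum_le _ _).trans (Finset.sum_le_sum fun j _ => hpiece j)) hM₂
    _ = M₂ * (∑ j, ‖b j‖) * W (ιB (blkOf i.D.toDomains p.1)) y' * Bμ := by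
        rw [← Finset.sum_mul]; ring

end ReadCore

/-! ## §4 READ at def-Y's entries: `EBlock (kernelFamilyS …) B₀ δ U₁` ⇒ the four block majorants at `cfg U₁` -/

section Read

variable {B : B9.Backgrounds} (cfg : B.Cfg → CfgY 𝔸 i) (O : SiteOpY 𝔸 i) (par : SiteParY 𝔸 i) {B₀ δ : ℝ} {U₁ : B.Cfg}

/-- ★ entry 0 READ pointwise: `η²‖(O(V)(f ⊗ E))(z)‖ ≤ B₀ℓ(y)²e^{−δd(y,y′)}|f|` for `‖E‖ ≤ 1`, `supp f ⊂ Δ(βy′)`, `z ∈ Δ(βy)`.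
[cite: Balaban1985BackgroundPropagators, (3.42) p.397 (first member)] -/
theorem sq_eta_mul_norm_le_of_eBlock (hE : EBlock (kernelFamilyS i B cfg O par) B₀ δ U₁)
    {M₂ : ℝ} (hM₂ : 0 ≤ M₂) (hrepr : ∀ (v : 𝔸) (j : ι), |b.repr v j| ≤ M₂ * ‖v‖)
    (f : SiteY i → ℝ) (y y' : IBondY i) (hs : (geo9K i).suppIn (Sum.inl f) y') {E : 𝔸} (hE1 : ‖E‖ ≤ 1)
    {z : SiteY i} (hz : blkOf i.D.toDomains z = β i.hN i.D i.hk y) :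
    etaS i ^ 2 * ‖O (cfg U₁) (liftY f E) z‖ ≤
      B₀ * (geo9K i).len y ^ 2 * Real.exp (-(δ * (geo9K i).dist y y')) * (geo9K i).supNorm (Sum.inl f) := by
  have h := hE 0 (Sum.inl f) y y' hs
  have hK : (kernelFamilyS i B cfg O par).e 0 U₁ (Sum.inl f) y =
      etaS i ^ (epow 0) * ⨆ E' : BallY 𝔸, eLatS i O (cfg U₁) (liftY f (E' : 𝔸)) (β i.hN i.D i.hk y) 0 := rfl
  have h0 : epow 0 = 2 := rfl
  have hp : B9.pref4 ((geo9K i).len y) 0 = (geo9K i).len y ^ 2 := rfl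
  rw [hK, h0, hp] at h
  refine le_trans (mul_le_mul_of_nonneg_left ?_ (sq_nonneg _)) h
  have hbd : ∀ E' : BallY 𝔸, eLatS i O (cfg U₁) (liftY f (E' : 𝔸)) (β i.hN i.D i.hk y) 0 ≤
      M₂ * ∑ j, ∑ w, ‖((O (cfg U₁)).restrictScalars ℝ) (liftY f (b j)) w‖ := fun E' =>
    supBlkS_le i _ _ (mul_nonneg hM₂ (Finset.sum_nonneg fun _ _ => Finset.sum_nonneg fun _ _ => norm_nonneg _)) fun w _ =>
      norm_apply_liftY_le_of_repr i b ((O (cfg U₁)).restrictScalars ℝ) hM₂ hrepr f (mem_closedBall_zero_iff.1 E'.2) w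
  have h1 := le_iSup_ball hbd ⟨E, mem_closedBall_zero_iff.2 hE1⟩
  exact (norm_le_supBlkS i _ (O (cfg U₁) (liftY f E)) hz).trans h1

/-- ★ entry 1 READ pointwise: `η‖(∇_{V,μ}O(V)(f ⊗ E))(z)‖ ≤ B₀ℓ(y)e^{−δd(y,y′)}|f|`. [cite: Balaban1985BackgroundPropagators, (3.42) p.397 (second member)] -/
theorem eta_mul_norm_cdS_le_of_eBlock (hE : EBlock (kernelFamilyS i B cfg O par) B₀ δ U₁)
    {M₂ : ℝ} (hM₂ : 0 ≤ M₂) (hrepr : ∀ (v : 𝔸) (j : ι), |b.repr v j| ≤ M₂ * ‖v‖)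
    (f : SiteY i → ℝ) (y y' : IBondY i) (hs : (geo9K i).suppIn (Sum.inl f) y') {E : 𝔸} (hE1 : ‖E‖ ≤ 1)
    {z : SiteY i} (μ : Fin (d + 1)) (hz : blkOf i.D.toDomains z = β i.hN i.D i.hk y) :
    etaS i * ‖cdS i (cfg U₁) μ (O (cfg U₁) (liftY f E)) z‖ ≤
      B₀ * (geo9K i).len y * Real.exp (-(δ * (geo9K i).dist y y')) * (geo9K i).supNorm (Sum.inl f) := by
  have h := hE 1 (Sum.inl f) y y' hs
  have hK : (kernelFamilyS i B cfg O par).e 1 U₁ (Sum.inl f) y =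
      etaS i ^ (epow 1) * ⨆ E' : BallY 𝔸, eLatS i O (cfg U₁) (liftY f (E' : 𝔸)) (β i.hN i.D i.hk y) 1 := rfl
  have h0 : epow 1 = 1 := rfl
  have hp : B9.pref4 ((geo9K i).len y) 1 = (geo9K i).len y := rfl
  rw [hK, h0, hp, pow_one] at h
  refine le_trans (mul_le_mul_of_nonneg_left ?_ (etaS_pos i).le) h
  have hC0 : 0 ≤ M₂ * ∑ ν : Fin (d + 1), ∑ j, ∑ w, ‖((cdSL i (cfg U₁) ν).restrictScalars ℝ ∘ₗ (O (cfg U₁)).restrictScalars ℝ) (liftY f (b j)) w‖ :=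
    mul_nonneg hM₂ (Finset.sum_nonneg fun _ _ => Finset.sum_nonneg fun _ _ => Finset.sum_nonneg fun _ _ => norm_nonneg _)
  have hbd : ∀ E' : BallY 𝔸, eLatS i O (cfg U₁) (liftY f (E' : 𝔸)) (β i.hN i.D i.hk y) 1 ≤
      M₂ * ∑ ν : Fin (d + 1), ∑ j, ∑ w, ‖((cdSL i (cfg U₁) ν).restrictScalars ℝ ∘ₗ (O (cfg U₁)).restrictScalars ℝ) (liftY f (b j)) w‖ := fun E' =>
    supBlkS'_le i _ _ hC0 fun w ν _ =>
      (norm_apply_liftY_le_of_repr i b ((cdSL i (cfg U₁) ν).restrictScalars ℝ ∘ₗ (O (cfg U₁)).restrictScalars ℝ) hM₂ hrepr f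
        (mem_closedBall_zero_iff.1 E'.2) w).trans (mul_le_mul_of_nonneg_left (Finset.single_le_sum
          (f := fun ν : Fin (d + 1) => ∑ j, ∑ w, ‖((cdSL i (cfg U₁) ν).restrictScalars ℝ ∘ₗ (O (cfg U₁)).restrictScalars ℝ) (liftY f (b j)) w‖)
          (fun _ _ => Finset.sum_nonneg fun _ _ => Finset.sum_nonneg fun _ _ => norm_nonneg _) (Finset.mem_univ ν)) hM₂)
  have h1 := le_iSup_ball hbd ⟨E, mem_closedBall_zero_iff.2 hE1⟩
  exact (norm_le_supBlkS' i _ (fun ν => cdS i (cfg U₁) ν (O (cfg U₁) (liftY f E))) μ hz).trans h1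

/-- ★ entry 2 READ pointwise: `η‖(O(V)∇*_{V,μ}(f ⊗ E))(z)‖ ≤ B₀ℓ(y)e^{−δd(y,y′)}|f|`. [cite: Balaban1985BackgroundPropagators, (3.42) p.397 (third member)] -/
theorem eta_mul_norm_cdsS_le_of_eBlock (hE : EBlock (kernelFamilyS i B cfg O par) B₀ δ U₁)
    {M₂ : ℝ} (hM₂ : 0 ≤ M₂) (hrepr : ∀ (v : 𝔸) (j : ι), |b.repr v j| ≤ M₂ * ‖v‖)
    (f : SiteY i → ℝ) (y y' : IBondY i) (hs : (geo9K i).suppIn (Sum.inl f) y') {E : 𝔸} (hE1 : ‖E‖ ≤ 1)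
    {z : SiteY i} (μ : Fin (d + 1)) (hz : blkOf i.D.toDomains z = β i.hN i.D i.hk y) :
    etaS i * ‖O (cfg U₁) (cdsS i (cfg U₁) μ (liftY f E)) z‖ ≤
      B₀ * (geo9K i).len y * Real.exp (-(δ * (geo9K i).dist y y')) * (geo9K i).supNorm (Sum.inl f) := by
  have h := hE 2 (Sum.inl f) y y' hs
  have hK : (kernelFamilyS i B cfg O par).e 2 U₁ (Sum.inl f) y =
      etaS i ^ (epow 2) * ⨆ E' : BallY 𝔸, eLatS i O (cfg U₁) (liftY f (E' : 𝔸)) (β i.hN i.D i.hk y) 2 := rfl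
  have h0 : epow 2 = 1 := rfl
  have hp : B9.pref4 ((geo9K i).len y) 2 = (geo9K i).len y := rfl
  rw [hK, h0, hp, pow_one] at h
  refine le_trans (mul_le_mul_of_nonneg_left ?_ (etaS_pos i).le) h
  have hC0 : 0 ≤ M₂ * ∑ ν : Fin (d + 1), ∑ j, ∑ w, ‖((O (cfg U₁)).restrictScalars ℝ ∘ₗ (cdsSL i (cfg U₁) ν).restrictScalars ℝ) (liftY f (b j)) w‖ :=
    mul_nonneg hM₂ (Finset.sum_nonneg fun _ _ => Finset.sum_nonneg fun _ _ => Finset.sum_nonneg fun _ _ => norm_nonneg _)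
  have hbd : ∀ E' : BallY 𝔸, eLatS i O (cfg U₁) (liftY f (E' : 𝔸)) (β i.hN i.D i.hk y) 2 ≤
      M₂ * ∑ ν : Fin (d + 1), ∑ j, ∑ w, ‖((O (cfg U₁)).restrictScalars ℝ ∘ₗ (cdsSL i (cfg U₁) ν).restrictScalars ℝ) (liftY f (b j)) w‖ := fun E' =>
    supBlkS'_le i _ _ hC0 fun w ν _ =>
      (norm_apply_liftY_le_of_repr i b ((O (cfg U₁)).restrictScalars ℝ ∘ₗ (cdsSL i (cfg U₁) ν).restrictScalars ℝ) hM₂ hrepr f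
        (mem_closedBall_zero_iff.1 E'.2) w).trans (mul_le_mul_of_nonneg_left (Finset.single_le_sum
          (f := fun ν : Fin (d + 1) => ∑ j, ∑ w, ‖((O (cfg U₁)).restrictScalars ℝ ∘ₗ (cdsSL i (cfg U₁) ν).restrictScalars ℝ) (liftY f (b j)) w‖)
          (fun _ _ => Finset.sum_nonneg fun _ _ => Finset.sum_nonneg fun _ _ => norm_nonneg _) (Finset.mem_univ ν)) hM₂)
  have h1 := le_iSup_ball hbd ⟨E, mem_closedBall_zero_iff.2 hE1⟩
  exact (norm_le_supBlkS' i _ (fun ν => O (cfg U₁) (cdsS i (cfg U₁) ν (liftY f E))) μ hz).trans h1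

/-- ★ entry 3 READ pointwise: `‖(Δ_V O(V)(f ⊗ E))(z)‖ ≤ B₀e^{−δd(y,y′)}|f|`. [cite: Balaban1985BackgroundPropagators, (3.42) p.397 (fourth member)] -/
theorem norm_lapS_le_of_eBlock (hE : EBlock (kernelFamilyS i B cfg O par) B₀ δ U₁)
    {M₂ : ℝ} (hM₂ : 0 ≤ M₂) (hrepr : ∀ (v : 𝔸) (j : ι), |b.repr v j| ≤ M₂ * ‖v‖)
    (f : SiteY i → ℝ) (y y' : IBondY i) (hs : (geo9K i).suppIn (Sum.inl f) y') {E : 𝔸} (hE1 : ‖E‖ ≤ 1)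
    {z : SiteY i} (hz : blkOf i.D.toDomains z = β i.hN i.D i.hk y) :
    ‖lapS i (cfg U₁) (O (cfg U₁) (liftY f E)) z‖ ≤
      B₀ * 1 * Real.exp (-(δ * (geo9K i).dist y y')) * (geo9K i).supNorm (Sum.inl f) := by
  have h := hE 3 (Sum.inl f) y y' hs
  have hK : (kernelFamilyS i B cfg O par).e 3 U₁ (Sum.inl f) y =
      etaS i ^ (epow 3) * ⨆ E' : BallY 𝔸, eLatS i O (cfg U₁) (liftY f (E' : 𝔸)) (β i.hN i.D i.hk y) 3 := rfl
  have h0 : epow 3 = 0 := rfl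
  have hp : B9.pref4 ((geo9K i).len y) 3 = 1 := rfl
  rw [hK, h0, hp, pow_zero, one_mul] at h
  refine le_trans ?_ h
  have hC0 : 0 ≤ M₂ * ∑ j, ∑ w, ‖(lapSₗ i (cfg U₁) ∘ₗ (O (cfg U₁)).restrictScalars ℝ) (liftY f (b j)) w‖ :=
    mul_nonneg hM₂ (Finset.sum_nonneg fun _ _ => Finset.sum_nonneg fun _ _ => norm_nonneg _)
  have hbd : ∀ E' : BallY 𝔸, eLatS i O (cfg U₁) (liftY f (E' : 𝔸)) (β i.hN i.D i.hk y) 3 ≤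
      M₂ * ∑ j, ∑ w, ‖(lapSₗ i (cfg U₁) ∘ₗ (O (cfg U₁)).restrictScalars ℝ) (liftY f (b j)) w‖ := fun E' =>
    supBlkS_le i _ _ hC0 fun w _ => by
      have h2 := norm_apply_liftY_le_of_repr i b (lapSₗ i (cfg U₁) ∘ₗ (O (cfg U₁)).restrictScalars ℝ) hM₂ hrepr f (mem_closedBall_zero_iff.1 E'.2) w
      rw [LinearMap.comp_apply, lapSₗ_apply] at h2
      exact h2
  have h1 := le_iSup_ball hbd ⟨E, mem_closedBall_zero_iff.2 hE1⟩
  exact (norm_le_supBlkS i _ (lapS i (cfg U₁) (O (cfg U₁) (liftY f E))) hz).trans h1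

variable [Fintype (geo9K i).Site] {Rr : ℝ} {Hp : Prop}

/-- ★★ **READ, entry 0 ⇒ the majorant of `conj b (η²O(V))`** with constant `M₂(Σ‖b_j‖)B₀`, profile `ℓ(a)²`, SAME rate `δ`.
[cite: Balaban1985BackgroundPropagators, (3.42) p.397 (first member); Balaban1984PropagatorsII, (2.51) p.232] -/
theorem hasMajorant_conj_G_of_eBlock (hE : EBlock (kernelFamilyS i B cfg O par) B₀ δ U₁) (hB₀ : 0 ≤ B₀)
    (ιB : BlkY i → IBondY i) (hι : ∀ s, β i.hN i.D i.hk (ιB s) = s)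
    {M₂ : ℝ} (hM₂ : 0 ≤ M₂) (hrepr : ∀ (v : 𝔸) (j : ι), |b.repr v j| ≤ M₂ * ‖v‖) {η : ℝ} (hη : η = etaS i)
    (G : Module.End ℝ (SiteY i → 𝔸)) (hG : ∀ Λ, G Λ = (η ^ 2) • O (cfg U₁) Λ) :
    HasMajorant (g := toB6 (geo9K i) Rr Hp) (fun p : SiteY i × ι => ιB (blkOf i.D.toDomains p.1)) (conj b G)
      (fun a a' => M₂ * (∑ j, ‖b j‖) * B₀ * (geo9K i).len a ^ 2 * Real.exp (-(δ * (geo9K i).dist a a'))) := by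
  subst hη
  have hGc : ∀ (c : ℂ) (Λ : SiteY i → 𝔸), G (c • Λ) = c • G Λ := by
    intro c Λ; rw [hG, hG, map_smul]; exact smul_comm _ _ _
  have h := hasMajorant_conj_of_ball_bound i b (Rr := Rr) (Hp := Hp) G hGc ιB hι hM₂ hrepr
    (fun a a' => B₀ * (geo9K i).len a ^ 2 * Real.exp (-(δ * (geo9K i).dist a a')))
    (fun a a' => mul_nonneg (mul_nonneg hB₀ (sq_nonneg _)) (Real.exp_pos _).le) ?_
  · exact hasMajorant_mono _ h fun a a' => le_of_eq (by ring)
  · intro f y y' hs E hE1 z hz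
    rw [hG, Pi.smul_apply, norm_smul, Real.norm_eq_abs, abs_of_nonneg (sq_nonneg _)]
    exact sq_eta_mul_norm_le_of_eBlock i b cfg O par hE hM₂ hrepr f y y' hs hE1 hz

/-- ★★ **READ, entry 1 ⇒ the majorant of `conj b (η⁻¹∇_μ-letter) * conj b (η²O(V))`** (forward letter `k = inl μ` on the LEFT), profile `ℓ(a)`, SAME rate.
[cite: Balaban1985BackgroundPropagators, (3.42) p.397 (second member); Balaban1984PropagatorsII, (2.51)–(2.52) p.232] -/
theorem hasMajorant_gradF_mul_G_of_eBlock (hE : EBlock (kernelFamilyS i B cfg O par) B₀ δ U₁) (hB₀ : 0 ≤ B₀)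
    (ιB : BlkY i → IBondY i) (hι : ∀ s, β i.hN i.D i.hk (ιB s) = s)
    {M₂ : ℝ} (hM₂ : 0 ≤ M₂) (hrepr : ∀ (v : 𝔸) (j : ι), |b.repr v j| ≤ M₂ * ‖v‖) {η : ℝ} (hη : η = etaS i)
    {Uc : Fin (d + 1) → SiteY i → 𝔸ˣ} (hUc : Uc = UboxY i (cfg U₁))
    (G : Module.End ℝ (SiteY i → 𝔸)) (hG : ∀ Λ, G Λ = (η ^ 2) • O (cfg U₁) Λ) (μ : Fin (d + 1)) :
    HasMajorant (g := toB6 (geo9K i) Rr Hp) (fun p : SiteY i × ι => ιB (blkOf i.D.toDomains p.1))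
      (conj b (diffLetter (shiftY i) Uc (((η : ℂ))⁻¹) (Sum.inl μ)) * conj b G)
      (fun a a' => M₂ * (∑ j, ‖b j‖) * B₀ * (geo9K i).len a * Real.exp (-(δ * (geo9K i).dist a a'))) := by
  subst hη hUc
  rw [← B9Eq352DivFormLetters.conj_mul, diffLetter_inl]
  have hη0 : 0 ≤ etaS i := (etaS_pos i).le
  have hTc : ∀ (c : ℂ) (Λ : SiteY i → 𝔸), (gradLetterF (shiftY i) (UboxY i (cfg U₁)) ((((etaS i : ℝ) : ℂ))⁻¹) μ * G) (c • Λ) =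
      c • (gradLetterF (shiftY i) (UboxY i (cfg U₁)) ((((etaS i : ℝ) : ℂ))⁻¹) μ * G) Λ := by
    intro c Λ; funext w
    rw [gradF_mul_apply i O (cfg U₁) G hG, Pi.smul_apply, gradF_mul_apply i O (cfg U₁) G hG, map_smul, cdS_smul, Pi.smul_apply]
    exact smul_comm _ _ _
  have h := hasMajorant_conj_of_ball_bound i b (Rr := Rr) (Hp := Hp) _ hTc ιB hι hM₂ hrepr
    (fun a a' => B₀ * (geo9K i).len a * Real.exp (-(δ * (geo9K i).dist a a')))
    (fun a a' => mul_nonneg (mul_nonneg hB₀ (geo9K_len_nonneg i a)) (Real.exp_pos _).le) ?_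
  · exact hasMajorant_mono _ h fun a a' => le_of_eq (by ring)
  · intro f y y' hs E hE1 z hz
    rw [gradF_mul_apply i O (cfg U₁) G hG, norm_smul, Complex.norm_real, Real.norm_eq_abs, abs_of_nonneg hη0]
    exact eta_mul_norm_cdS_le_of_eBlock i b cfg O par hE hM₂ hrepr f y y' hs hE1 μ hz

/-- ★★ **READ, entry 2 ⇒ the majorant of `conj b (η²O(V)) * conj b (−η⁻¹∇*_μ-letter)`** (backward letter `k = inr μ` on the RIGHT), profile `ℓ(a)`, SAME rate.
[cite: Balaban1985BackgroundPropagators, (3.42) p.397 (third member); Balaban1984PropagatorsII, (2.51)–(2.52) p.232] -/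
theorem hasMajorant_G_mul_gradB_of_eBlock (hE : EBlock (kernelFamilyS i B cfg O par) B₀ δ U₁) (hB₀ : 0 ≤ B₀)
    (ιB : BlkY i → IBondY i) (hι : ∀ s, β i.hN i.D i.hk (ιB s) = s)
    {M₂ : ℝ} (hM₂ : 0 ≤ M₂) (hrepr : ∀ (v : 𝔸) (j : ι), |b.repr v j| ≤ M₂ * ‖v‖) {η : ℝ} (hη : η = etaS i)
    {Uc : Fin (d + 1) → SiteY i → 𝔸ˣ} (hUc : Uc = UboxY i (cfg U₁))
    (G : Module.End ℝ (SiteY i → 𝔸)) (hG : ∀ Λ, G Λ = (η ^ 2) • O (cfg U₁) Λ) (μ : Fin (d + 1)) :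
    HasMajorant (g := toB6 (geo9K i) Rr Hp) (fun p : SiteY i × ι => ιB (blkOf i.D.toDomains p.1))
      (conj b G * conj b (diffLetter (shiftY i) Uc (((η : ℂ))⁻¹) (Sum.inr μ)))
      (fun a a' => M₂ * (∑ j, ‖b j‖) * B₀ * (geo9K i).len a * Real.exp (-(δ * (geo9K i).dist a a'))) := by
  subst hη hUc
  rw [← B9Eq352DivFormLetters.conj_mul, diffLetter_inr]
  have hη0 : 0 ≤ etaS i := (etaS_pos i).le
  have hTc : ∀ (c : ℂ) (Λ : SiteY i → 𝔸), (G * -gradLetterB (shiftY i) (UboxY i (cfg U₁)) ((((etaS i : ℝ) : ℂ))⁻¹) μ) (c • Λ) =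
      c • (G * -gradLetterB (shiftY i) (UboxY i (cfg U₁)) ((((etaS i : ℝ) : ℂ))⁻¹) μ) Λ := by
    intro c Λ; funext w
    rw [mul_neg_gradB_apply i O (cfg U₁) G hG, Pi.smul_apply, mul_neg_gradB_apply i O (cfg U₁) G hG, cdsS_smul, map_smul, Pi.smul_apply,
      smul_neg]
    congr 1
    exact smul_comm _ _ _
  have h := hasMajorant_conj_of_ball_bound i b (Rr := Rr) (Hp := Hp) _ hTc ιB hι hM₂ hrepr
    (fun a a' => B₀ * (geo9K i).len a * Real.exp (-(δ * (geo9K i).dist a a')))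
    (fun a a' => mul_nonneg (mul_nonneg hB₀ (geo9K_len_nonneg i a)) (Real.exp_pos _).le) ?_
  · exact hasMajorant_mono _ h fun a a' => le_of_eq (by ring)
  · intro f y y' hs E hE1 z hz
    rw [mul_neg_gradB_apply i O (cfg U₁) G hG, norm_neg, norm_smul, Complex.norm_real, Real.norm_eq_abs, abs_of_nonneg hη0]
    exact eta_mul_norm_cdsS_le_of_eBlock i b cfg O par hE hM₂ hrepr f y y' hs hE1 μ hz

/-- ★★ **READ, entry 3 ⇒ the majorant of `conj b (η⁻²Δ_V) * conj b (η²O(V))`**, profile `1`, SAME rate.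
[cite: Balaban1985BackgroundPropagators, (3.42) p.397 (fourth member); Balaban1984PropagatorsII, (2.51)–(2.52) p.232] -/
theorem hasMajorant_lap_mul_G_of_eBlock (hE : EBlock (kernelFamilyS i B cfg O par) B₀ δ U₁) (hB₀ : 0 ≤ B₀)
    (ιB : BlkY i → IBondY i) (hι : ∀ s, β i.hN i.D i.hk (ιB s) = s)
    {M₂ : ℝ} (hM₂ : 0 ≤ M₂) (hrepr : ∀ (v : 𝔸) (j : ι), |b.repr v j| ≤ M₂ * ‖v‖) {η : ℝ} (hη : η = etaS i)
    (G L : Module.End ℝ (SiteY i → 𝔸)) (hG : ∀ Λ, G Λ = (η ^ 2) • O (cfg U₁) Λ) (hL : ∀ Λ, L Λ = (η ^ 2)⁻¹ • lapS i (cfg U₁) Λ) :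
    HasMajorant (g := toB6 (geo9K i) Rr Hp) (fun p : SiteY i × ι => ιB (blkOf i.D.toDomains p.1)) (conj b L * conj b G)
      (fun a a' => M₂ * (∑ j, ‖b j‖) * B₀ * 1 * Real.exp (-(δ * (geo9K i).dist a a'))) := by
  subst hη
  rw [← B9Eq352DivFormLetters.conj_mul]
  have hTc : ∀ (c : ℂ) (Λ : SiteY i → 𝔸), (L * G) (c • Λ) = c • (L * G) Λ := by
    intro c Λ; funext w
    have hlap : lapS i (cfg U₁) (c • O (cfg U₁) Λ) = c • lapS i (cfg U₁) (O (cfg U₁) Λ) := by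
      funext x; simp only [lapS, Pi.smul_apply, Finset.smul_sum, cdS_smul, cdsS_smul]
    rw [lap_mul_apply i O (cfg U₁) G L hG hL, Pi.smul_apply, lap_mul_apply i O (cfg U₁) G L hG hL, map_smul, hlap, Pi.smul_apply]
  have h := hasMajorant_conj_of_ball_bound i b (Rr := Rr) (Hp := Hp) _ hTc ιB hι hM₂ hrepr
    (fun a a' => B₀ * 1 * Real.exp (-(δ * (geo9K i).dist a a')))
    (fun a a' => mul_nonneg (mul_nonneg hB₀ zero_le_one) (Real.exp_pos _).le) ?_
  · exact hasMajorant_mono _ h fun a a' => le_of_eq (by ring)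
  · intro f y y' hs E hE1 z hz
    rw [lap_mul_apply i O (cfg U₁) G L hG hL]
    exact norm_lapS_le_of_eBlock i b cfg O par hE hM₂ hrepr f y y' hs hE1 hz

end Read

/-! ## §5 WRITE at the same configuration: the four block majorants at `cfg U₁` ⇒ `EBlock (kernelFamilyS …) (M₂(Σ_j‖b_j‖)B) δ U₁` -/

section Write

variable {B : B9.Backgrounds} (cfg : B.Cfg → CfgY 𝔸 i) (O : SiteOpY 𝔸 i) (par : SiteParY 𝔸 i) {U₁ : B.Cfg}
variable [Fintype (geo9K i).Site] {Rr : ℝ} {Hp : Prop}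

omit [CompleteSpace 𝔸] in
/-- ★ **THE (2.51) WRITING THROUGH COORDINATES**: a block majorant `K` of `conj b T` w.r.t. `(z, j) ↦ ιB(Δ(z))` bounds `‖(T(f ⊗ E))(z)‖` for `‖E‖ ≤ 1`,
`supp f ⊂ Δ(βy′)` by `(Σ_j‖b_j‖)·K(ιB(Δ(z)), ιB(βy′))·M₂|f|` (the coordinates of `f ⊗ E` are supported in the block of `ιB(βy′)` and bounded by `M₂|f|`).
[cite: Balaban1984PropagatorsII, (2.51) p.232 («|(Tλ)(x)| ≤ K(y,y′)|λ|»); Balaban1985BackgroundPropagators, (3.42) p.397] -/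
theorem norm_apply_liftY_le_of_hasMajorant (T : Module.End ℝ (SiteY i → 𝔸)) (ιB : BlkY i → IBondY i)
    {M₂ : ℝ} (hM₂ : 0 ≤ M₂) (hrepr : ∀ (v : 𝔸) (j : ι), |b.repr v j| ≤ M₂ * ‖v‖) {Kmaj : IBondY i → IBondY i → ℝ}
    (h : HasMajorant (g := toB6 (geo9K i) Rr Hp) (fun p : SiteY i × ι => ιB (blkOf i.D.toDomains p.1)) (conj b T) Kmaj)
    (f : SiteY i → ℝ) (y' : IBondY i) (hs : (geo9K i).suppIn (Sum.inl f) y') {E : 𝔸} (hE : ‖E‖ ≤ 1) (z : SiteY i) :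
    ‖T (liftY f E) z‖ ≤ (∑ j, ‖b j‖) * (Kmaj (ιB (blkOf i.D.toDomains z)) (ιB (β i.hN i.D i.hk y')) * (M₂ * (geo9K i).supNorm (Sum.inl f))) := by
  have hN0 : 0 ≤ (geo9K i).supNorm (Sum.inl f) := geo9K_supNorm_nonneg i _
  have hBS : BlockSupp (g := toB6 (geo9K i) Rr Hp) (fun p : SiteY i × ι => ιB (blkOf i.D.toDomains p.1)) (coordEquiv b (liftY f E))
      (ιB (β i.hN i.D i.hk y')) (M₂ * (geo9K i).supNorm (Sum.inl f)) := by
    refine ⟨mul_nonneg hM₂ hN0, fun p _ => ?_, fun p hp => ?_⟩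
    · rw [coordEquiv_apply, liftY_apply, Complex.coe_smul, map_smul, Finsupp.smul_apply, smul_eq_mul, abs_mul]
      calc |f p.1| * |b.repr E p.2| ≤ (geo9K i).supNorm (Sum.inl f) * (M₂ * ‖E‖) :=
            mul_le_mul (abs_le_supNorm_inl i f p.1) (hrepr E p.2) (abs_nonneg _) hN0
        _ ≤ (geo9K i).supNorm (Sum.inl f) * M₂ := mul_le_mul_of_nonneg_left (mul_le_of_le_one_right hM₂ hE) hN0
        _ = M₂ * (geo9K i).supNorm (Sum.inl f) := mul_comm _ _
    · have hf : f p.1 = 0 := by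
        by_contra hf
        exact hp (congrArg ιB (hs p.1 hf))
      rw [coordEquiv_apply, liftY_apply, hf, Complex.ofReal_zero, zero_smul, map_zero, Finsupp.zero_apply]
  have hco : ∀ j : ι, |b.repr (T (liftY f E) z) j| ≤
      Kmaj (ιB (blkOf i.D.toDomains z)) (ιB (β i.hN i.D i.hk y')) * (M₂ * (geo9K i).supNorm (Sum.inl f)) := by
    intro j
    have h1 := h _ _ _ hBS (z, j)
    simpa only [conj_apply, LinearEquiv.symm_apply_apply] using h1
  exact norm_le_basisBound_mul b _ hco

/-- ★★★ **WRITE AT ONE CONFIGURATION**: block majorants `B·ℓ(a)^{(2,1,1,0)}·e^{−δd(a,a′)}` of the four conjugated letters at `cfg U₁` — `conj b (η²O)`,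
`conj b (η⁻¹∇_μ-letter) * conj b (η²O)` (every `μ`), `conj b (η²O) * conj b (−η⁻¹∇*_μ-letter)` (every `μ`), `conj b (η⁻²Δ) * conj b (η²O)` — give the
(3.42) block of def-Y's reading `kernelFamilyS i B cfg O par` at `U₁` with constant `M₂(Σ_j‖b_j‖)·B` and the SAME rate `δ` (the same-configuration half of
dag-n06-c's `GpFrame₂.write342`; the `U ↦ U′U` letter conversion is not performed here). [cite: Balaban1985BackgroundPropagators, (3.42) p.397; Balaban1984PropagatorsII, (2.51)–(2.52) p.232] -/
theorem eBlock_kernelFamilyS_of_hasMajorant (ιB : BlkY i → IBondY i) (hι : ∀ s, β i.hN i.D i.hk (ιB s) = s)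
    {M₂ : ℝ} (hM₂ : 0 ≤ M₂) (hrepr : ∀ (v : 𝔸) (j : ι), |b.repr v j| ≤ M₂ * ‖v‖) {η : ℝ} (hη : η = etaS i)
    {Uc : Fin (d + 1) → SiteY i → 𝔸ˣ} (hUc : Uc = UboxY i (cfg U₁))
    (G L : Module.End ℝ (SiteY i → 𝔸)) (hG : ∀ Λ, G Λ = (η ^ 2) • O (cfg U₁) Λ) (hL : ∀ Λ, L Λ = (η ^ 2)⁻¹ • lapS i (cfg U₁) Λ)
    {Bc δ : ℝ} (hBc : 0 ≤ Bc)
    (h0 : HasMajorant (g := toB6 (geo9K i) Rr Hp) (fun p : SiteY i × ι => ιB (blkOf i.D.toDomains p.1)) (conj b G)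
      (fun a a' => Bc * (geo9K i).len a ^ 2 * Real.exp (-(δ * (geo9K i).dist a a'))))
    (h1 : ∀ μ : Fin (d + 1), HasMajorant (g := toB6 (geo9K i) Rr Hp) (fun p : SiteY i × ι => ιB (blkOf i.D.toDomains p.1))
      (conj b (diffLetter (shiftY i) Uc (((η : ℂ))⁻¹) (Sum.inl μ)) * conj b G)
      (fun a a' => Bc * (geo9K i).len a * Real.exp (-(δ * (geo9K i).dist a a'))))
    (h2 : ∀ μ : Fin (d + 1), HasMajorant (g := toB6 (geo9K i) Rr Hp) (fun p : SiteY i × ι => ιB (blkOf i.D.toDomains p.1))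
      (conj b G * conj b (diffLetter (shiftY i) Uc (((η : ℂ))⁻¹) (Sum.inr μ)))
      (fun a a' => Bc * (geo9K i).len a * Real.exp (-(δ * (geo9K i).dist a a'))))
    (h3 : HasMajorant (g := toB6 (geo9K i) Rr Hp) (fun p : SiteY i × ι => ιB (blkOf i.D.toDomains p.1)) (conj b L * conj b G)
      (fun a a' => Bc * 1 * Real.exp (-(δ * (geo9K i).dist a a')))) :
    EBlock (kernelFamilyS i B cfg O par) (M₂ * (∑ j, ‖b j‖) * Bc) δ U₁ := by
  subst hη hUc
  have hSb : 0 ≤ ∑ j, ‖b j‖ := Finset.sum_nonneg fun _ _ => norm_nonneg _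
  have hC : 0 ≤ M₂ * (∑ j, ‖b j‖) * Bc := mul_nonneg (mul_nonneg hM₂ hSb) hBc
  intro n lam y y' hs
  have hRHS : 0 ≤ M₂ * (∑ j, ‖b j‖) * Bc * B9.pref4 ((geo9K i).len y) n * Real.exp (-(δ * (geo9K i).dist y y')) * (geo9K i).supNorm lam :=
    mul_nonneg (mul_nonneg (mul_nonneg hC (pref4_nonneg _ (geo9K_len_nonneg i y) n)) (Real.exp_pos _).le) (geo9K_supNorm_nonneg i lam)
  cases lam with
  | inr J => exact hRHS
  | inl f =>
    have hR : ∀ {P : ℝ}, 0 ≤ P →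
        0 ≤ M₂ * (∑ j, ‖b j‖) * Bc * P * Real.exp (-(δ * (geo9K i).dist y y')) * (geo9K i).supNorm (Sum.inl f) := fun hP =>
      mul_nonneg (mul_nonneg (mul_nonneg hC hP) (Real.exp_pos _).le) (geo9K_supNorm_nonneg i _)
    have hlen : ∀ z : SiteY i, blkOf i.D.toDomains z = β i.hN i.D i.hk y → (geo9K i).len (ιB (blkOf i.D.toDomains z)) = (geo9K i).len y :=
      fun z hz => geo9K_len_congr i (by rw [hι]; exact hz)
    have hdist : ∀ z : SiteY i, blkOf i.D.toDomains z = β i.hN i.D i.hk y →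
        (geo9K i).dist (ιB (blkOf i.D.toDomains z)) (ιB (β i.hN i.D i.hk y')) = (geo9K i).dist y y' :=
      fun z hz => geo9K_dist_congr i (by rw [hι]; exact hz) (hι _)
    fin_cases n
    · -- (3.42)₁: η²·sup_E sup_{z ∈ Δ(y)} ‖(O(f ⊗ E))(z)‖
      show etaS i ^ (epow 0) * (⨆ E : BallY 𝔸, eLatS i O (cfg U₁) (liftY f (E : 𝔸)) (β i.hN i.D i.hk y) 0) ≤
        M₂ * (∑ j, ‖b j‖) * Bc * ((geo9K i).len y ^ 2) * Real.exp (-(δ * (geo9K i).dist y y')) * (geo9K i).supNorm (Sum.inl f)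
      have h0e : epow 0 = 2 := rfl
      have hη : 0 < etaS i ^ 2 := pow_pos (etaS_pos i) 2
      rw [h0e, mul_comm, ← le_div_iff₀ hη]
      refine iSup_ball_le (fun E => ?_) (div_nonneg (hR (sq_nonneg _)) hη.le)
      show supBlkS i (β i.hN i.D i.hk y) (O (cfg U₁) (liftY f (E : 𝔸))) ≤ _
      refine supBlkS_le i _ _ (div_nonneg (hR (sq_nonneg _)) hη.le) fun z hz => ?_
      rw [le_div_iff₀ hη, mul_comm]
      have hw := norm_apply_liftY_le_of_hasMajorant i b (Rr := Rr) (Hp := Hp) G ιB hM₂ hrepr h0 f y' hs (mem_closedBall_zero_iff.1 E.2) z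
      rw [hG, Pi.smul_apply, norm_smul, Real.norm_eq_abs, abs_of_nonneg (sq_nonneg _), hlen z hz, hdist z hz] at hw
      exact hw.trans (le_of_eq (by ring))
    · -- (3.42)₂: η·sup ‖(∇_{V,μ}O(f ⊗ E))(z)‖
      show etaS i ^ (epow 1) * (⨆ E : BallY 𝔸, eLatS i O (cfg U₁) (liftY f (E : 𝔸)) (β i.hN i.D i.hk y) 1) ≤
        M₂ * (∑ j, ‖b j‖) * Bc * (geo9K i).len y * Real.exp (-(δ * (geo9K i).dist y y')) * (geo9K i).supNorm (Sum.inl f)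
      have h1e : epow 1 = 1 := rfl
      have hη : 0 < etaS i := etaS_pos i
      rw [h1e, pow_one, mul_comm, ← le_div_iff₀ hη]
      refine iSup_ball_le (fun E => ?_) (div_nonneg (hR (geo9K_len_nonneg i y)) hη.le)
      show supBlkS' i (β i.hN i.D i.hk y) (fun ν => cdS i (cfg U₁) ν (O (cfg U₁) (liftY f (E : 𝔸)))) ≤ _
      refine supBlkS'_le i _ _ (div_nonneg (hR (geo9K_len_nonneg i y)) hη.le) fun z ν hz => ?_
      rw [le_div_iff₀ hη, mul_comm]
      have h1' := h1 ν
      rw [diffLetter_inl, ← B9Eq352DivFormLetters.conj_mul] at h1'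
      have hw := norm_apply_liftY_le_of_hasMajorant i b (Rr := Rr) (Hp := Hp) _ ιB hM₂ hrepr h1' f y' hs (mem_closedBall_zero_iff.1 E.2) z
      rw [gradF_mul_apply i O (cfg U₁) G hG, norm_smul, Complex.norm_real, Real.norm_eq_abs, abs_of_nonneg hη.le, hlen z hz, hdist z hz] at hw
      exact hw.trans (le_of_eq (by ring))
    · -- (3.42)₃: η·sup ‖(O∇*_{V,μ}(f ⊗ E))(z)‖
      show etaS i ^ (epow 2) * (⨆ E : BallY 𝔸, eLatS i O (cfg U₁) (liftY f (E : 𝔸)) (β i.hN i.D i.hk y) 2) ≤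
        M₂ * (∑ j, ‖b j‖) * Bc * (geo9K i).len y * Real.exp (-(δ * (geo9K i).dist y y')) * (geo9K i).supNorm (Sum.inl f)
      have h2e : epow 2 = 1 := rfl
      have hη : 0 < etaS i := etaS_pos i
      rw [h2e, pow_one, mul_comm, ← le_div_iff₀ hη]
      refine iSup_ball_le (fun E => ?_) (div_nonneg (hR (geo9K_len_nonneg i y)) hη.le)
      show supBlkS' i (β i.hN i.D i.hk y) (fun ν => O (cfg U₁) (cdsS i (cfg U₁) ν (liftY f (E : 𝔸)))) ≤ _
      refine supBlkS'_le i _ _ (div_nonneg (hR (geo9K_len_nonneg i y)) hη.le) fun z ν hz => ?_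
      rw [le_div_iff₀ hη, mul_comm]
      have h2' := h2 ν
      rw [diffLetter_inr, ← B9Eq352DivFormLetters.conj_mul] at h2'
      have hw := norm_apply_liftY_le_of_hasMajorant i b (Rr := Rr) (Hp := Hp) _ ιB hM₂ hrepr h2' f y' hs (mem_closedBall_zero_iff.1 E.2) z
      rw [mul_neg_gradB_apply i O (cfg U₁) G hG, norm_neg, norm_smul, Complex.norm_real, Real.norm_eq_abs, abs_of_nonneg hη.le, hlen z hz,
        hdist z hz] at hw
      exact hw.trans (le_of_eq (by ring))
    · -- (3.42)₄: sup ‖(Δ_V O(f ⊗ E))(z)‖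
      show etaS i ^ (epow 3) * (⨆ E : BallY 𝔸, eLatS i O (cfg U₁) (liftY f (E : 𝔸)) (β i.hN i.D i.hk y) 3) ≤
        M₂ * (∑ j, ‖b j‖) * Bc * 1 * Real.exp (-(δ * (geo9K i).dist y y')) * (geo9K i).supNorm (Sum.inl f)
      have h3e : epow 3 = 0 := rfl
      rw [h3e, pow_zero, one_mul]
      refine iSup_ball_le (fun E => ?_) (hR zero_le_one)
      show supBlkS i (β i.hN i.D i.hk y) (lapS i (cfg U₁) (O (cfg U₁) (liftY f (E : 𝔸)))) ≤ _
      refine supBlkS_le i _ _ (hR zero_le_one) fun z hz => ?_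
      have h3' := h3
      rw [← B9Eq352DivFormLetters.conj_mul] at h3'
      have hw := norm_apply_liftY_le_of_hasMajorant i b (Rr := Rr) (Hp := Hp) _ ιB hM₂ hrepr h3' f y' hs (mem_closedBall_zero_iff.1 E.2) z
      rw [lap_mul_apply i O (cfg U₁) G L hG hL, hdist z hz] at hw
      exact hw.trans (le_of_eq (by ring))

end Write

end Literature.MathematicalPhysics.QuantumFieldTheory.Balaban1983to89.Node00.OpsYRead342
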